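import Literature.MathematicalPhysics.QuantumFieldTheory.Balaban1983to89.B9Eq326G1SupRowAdjoint

/-!
# `Balaban1983to89.B9Eq326G1PostcompRowOfLetters` — T. Bałaban, *Propagators for lattice gauge theories in a background field*, Commun. Math. Phys. **99** (1985)
# 389–434 [Balaban1985BackgroundPropagators] (3.25)–(3.27) pp. 394–395, Thm 3.1 (3.42) p. 397 (BOTH entries), Thm 3.3 p. 399, (3.49) p. 399, Thm 3.13 p. 426,
# with [Balaban1985Variational] (115) p. 294, (117) p. 295: **THE LOCAL LETTER (L) OF `D∘G₁` FOR ANY POST-COMPOSED OPERATOR `D` — the Woodbury assembly of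
# ne9-leaf-05's (K61) `B9Eq326G1SupRowOfLetters.local_letter_G1_of_letters` with the OUTER factor `A₀⁻¹` replaced by `D∘A₀⁻¹` (its own letter `B_D`, its own
# output carriers and block map), the INNER factor untouched: `D(G₁f) = (D∘A₀⁻¹)f + (D∘A₀⁻¹)(Uu((c + cVG₁Uu c)(V(A₀⁻¹f))))`** — the abstract half of the
# GRADIENT member of (117) for `G₁,k` (`D :=` the covariant slice derivative `u ↦ D_U u_μ`, letter = this lineage's (VGRC)
# `B9Eq326LocalInvTowerSliceGradientRowClosed`) and equally of the VALUE member's `D*_UG₁,k` (`D := D*_U`, letter = ne9-leaf-03's (DVTD)); NE9 owner INTENT-5 gen 96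

statement-level skeleton of published theorems with citation tags; proofs where landed; nothing here is a claim about the Yang–Mills mass gap

CITATION HEADER (lean-in-tree rule).  Audit cell `pub-balaban`, sub-cell `t4`, BINDER row NE9; filed by the NE9 BINDER-row OWNER lineage `b2b-balaban-t4-ne9-p1` (gen 96).
Imports ne9-leaf-05's (K62) `B9Eq326G1SupRowAdjoint` (through it (K61) `B9Eq326G1SupRowOfLetters`, ne9-leaf-03's `B9Eq347LocalLetterAdjoint`).  SOURCE READ first-hand in
the held text layer [Balaban1985BackgroundPropagators] (`paper:balaban1985-cmp99-background-propagators`): pp. 394–395 (3.25)–(3.27); p. 397 Thm 3.1 (3.42) (both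
entries: value AND covariant gradient); p. 399 Thm 3.3 (*«with G′(U) replaced by G(U)»*), (3.49); p. 426 Thm 3.13; [Balaban1985Variational] p. 294 (115), p. 295 (117)
(*«By Theorem 3.13 of [5] the norm max{|·|_{(−1)}, |∇·|_{(−2)}} of the transformation can be estimated by …»*).  Print proves the rows of `G` by the random walk of
Sect. 3 with the words (3.123)∕(3.147)∕(3.153); the cell's road is the Woodbury identity around the local part (this lineage's plan v11, `B9Eq326WoodburySchur(Tower)`)
and the (L)-letter algebra — [folklore] composition BY NAME; NOTHING of print's proof is reproduced; nothing printed is a hypothesis.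

WHAT IS PROVED (sorry-free; proof lane — 0 `def`; [folklore]).
* §1 **`local_letter_postcomp_of_letters`** — (K61) `local_letter_G1_of_letters`'s hypotheses VERBATIM (`hW hU hVA hC hGblk hUblk hVblk hS`) plus a continuous
  linear `D : WL2 w_B V →L WL2 w_X V_X` into ANY weighted carrier with block map `π_X` and the letter `hDA : (L)(D ∘L A₀⁻¹; B_D, κ)` ⟹
  `‖(D(G₁f))(x)‖ ≤ (B_D + B_D·B_U·B_c·B_V·S³·(1 + B_c·B_X·S²))·e^{−κ′δ(π_X x, v)}·F`, `B_X = C_V·A₁·C_U·S²·(√μ_Y∕√ω_Y)` — (K61)'s steps (a)–(e) unchanged, (f)(g)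
  with `D ∘L A₀⁻¹` as the outer factor, (h) the identity `D(G₁f) = (D∘A₀⁻¹)f + (D∘A₀⁻¹)(Uu(…))` from `hW` by linearity.
* §2 **`local_letter_postcomp_of_adjoint`** — §1 with `hVA`, `hUblk`, `hVblk` DERIVED from `Uu† = V`, `A₀⁻¹† = A₀⁻¹` and the INNER value letter
  `hA : (L)(A₀⁻¹; B_A, κ)` ((K62) `letter_VA_of_adjoint`, `block_letter_U_of_local`, `block_letter_V_of_adjoint`); the outer letter `hDA` separate.
* §3 **`local_letter_postcomp_torus_const`** — §2 over the coarse torus `T_m` (`δ := d_m`, `S := K_d((κ−κ′)∕2)` by `torusSum_le`, volume-free) at constant weights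
  (`w_Y ≡ c₁`, bond-block mass `≤ d_B·c₁`): constant `B_D + B_D·B_U·B_c·(B_U·B_A·K·d_B)·K³·(1 + B_c·((B_U√d_B)·A₁·(B_U√d_B)·K²)·K²)` — (K62)
  `local_letter_G1_torus_const`'s `B⋆` with the two OUTER `B_A` replaced by `B_D` — the form the END `exists_local_gradLetter_G1k` chooses its `B` in.
HONEST SCOPE.  (L)-letter algebra BY NAME; every letter DISPLAYED; constants symbolic and crude; `D` abstract (no derivative is typed here); nothing of [B9] Thm 3.1∕3.3∕
3.11∕3.13 is asserted, valued or discharged.  NOT NE9 (cell pub-balaban: NE9 NOT PRINTED ∕ NOT PROVED; «NE9 ⇐ the named binders»; row WALLED ON A MODEL (O-NE9-1; #5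
UNRULED); spine PROVED 0∕9; rung (B)+1 on a finite T⁴ — NOT infinite volume, NOT mass gap, NOT BetaPertH, NOT Clay; HONEST DEPENDENCY: continuum YM on T⁴ ⇐ BetaPertH ∧ nine
spine estimates (0/9 proved); BetaPertH ⇐ (D1) ∧ (D4) ∧ CAP+tail; G-an2-4 gates asym, D1 and NE2/3/4).  NEW file; nothing modified.  Net new unproved facts: 0.
-/

noncomputable section

set_option autoImplicit false

open scoped BigOperators InnerProductSpace

namespace Literature.MathematicalPhysics.QuantumFieldTheory.Balaban1983to89.B9Eq326G1PostcompRowOfLetters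

open B9Eq311L2Pairing (WL2)
open B4Sect5Torus (TSite tdist tdist_triangle tdist_nonneg tdist_symm torusSum_le)
open B4Sect5Proof (latticeConst latticeConst_nonneg)
open B9Eq326G1SupRowOfLetters (letter_comp letter_mono core_point_decay core_letter_of_point_decay)
open B9Eq326G1SupRowAdjoint (block_letter_U_of_local block_letter_V_of_adjoint letter_VA_of_adjoint)

/-! ## §1 The Woodbury assembly with a post-composed outer factor: abstract carriers, every letter displayed -/

section Assembly

variable {𝕜 : Type*} [RCLike 𝕜] {XB XX Y : Type*} [Fintype XB] [Fintype XX] [Fintype Y] [DecidableEq Y] [Nonempty XB] [Nonempty Y]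
  {wB : XB → ℝ} {wX : XX → ℝ} {wY : Y → ℝ} [Fact (∀ x, 0 < wB x)] [Fact (∀ x, 0 < wX x)] [Fact (∀ y, 0 < wY y)]
  {V VX : Type*} [NormedAddCommGroup V] [InnerProductSpace 𝕜 V] [NormedAddCommGroup VX] [InnerProductSpace 𝕜 VX]
  (πB : XB → Y) (πX : XX → Y) (δ : Y → Y → ℝ) (hδ0 : ∀ u v, 0 ≤ δ u v) (hδt : ∀ u y v, δ u v ≤ δ u y + δ y v) (hδs : ∀ u v, δ u v = δ v u)
  {P : Y → WL2 𝕜 wB V →L[𝕜] WL2 𝕜 wB V}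
  (hP : ∀ (y : Y) (f : WL2 𝕜 wB V) (x : XB), WL2.equiv 𝕜 wB V (P y f) x = if πB x = y then WL2.equiv 𝕜 wB V f x else 0)
  {rY : Y → WL2 𝕜 wY V →L[𝕜] WL2 𝕜 wY V}
  (hrY : ∀ (y : Y) (g : WL2 𝕜 wY V) (u : Y), WL2.equiv 𝕜 wY V (rY y g) u = if u = y then WL2.equiv 𝕜 wY V g u else 0)
  (A G : WL2 𝕜 wB V →L[𝕜] WL2 𝕜 wB V) (Uop : WL2 𝕜 wY V →L[𝕜] WL2 𝕜 wB V) (Vop : WL2 𝕜 wB V →L[𝕜] WL2 𝕜 wY V)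
  (C : WL2 𝕜 wY V →L[𝕜] WL2 𝕜 wY V) (D : WL2 𝕜 wB V →L[𝕜] WL2 𝕜 wX VX)

include hδ0 hδt hδs hP hrY in
/-- **THE LETTER (L) OF `D∘G₁` FROM THE LETTERS OF ITS FACTORS** ((K61) `local_letter_G1_of_letters` with a post-composed outer factor).  DISPLAYED: the Woodbury
identity `hW`; (L)(D∘A₀⁻¹; B_D, κ) from the bond carriers `(w_B, π_B)` to ANY carriers `(w_X, π_X)`; (L)(Uu; B_U, κ); (L)(V∘A₀⁻¹; B_V, κ′); (L)(c; B_c, κ); the three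
block letters `A₁, C_U, C_V`; `ω_Y ≤ w_Y ≤ μ_Y`; `0 ≤ κ′ < κ`; ONE row constant `S` at the gap `(κ−κ′)∕2`.  CONCLUSION: for `f` supported over `π_B⁻¹(v)` with
`‖f‖_∞ ≤ F` and every output index `x`, `‖(D(G₁f))(x)‖ ≤ (B_D + B_D·B_U·B_c·B_V·S³·(1 + B_c·B_X·S²))·e^{−κ′δ(π_X x, v)}·F`, `B_X = C_V·A₁·C_U·S²·(√μ_Y∕√ω_Y)`.
[folklore] [cite: Balaban1985BackgroundPropagators, (3.25)–(3.26) pp.394–395, Thm 3.1 (3.42) p.397, Thm 3.3 p.399, Thm 3.13 p.426, p.415 «random walk expansion»;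
Balaban1985Variational, (117) p.295] -/
theorem local_letter_postcomp_of_letters
    (hW : ∀ f, G f = A f + A (Uop ((C + C ∘L Vop ∘L G ∘L Uop ∘L C) (Vop (A f)))))
    {BD BU BV Bc A₁ CU CV κ κ' S ωY μY : ℝ} (hBD : 0 ≤ BD) (hBU : 0 ≤ BU) (hBV : 0 ≤ BV) (hBc : 0 ≤ Bc) (hA₁ : 0 ≤ A₁) (hCU : 0 ≤ CU)
    (hCV : 0 ≤ CV) (hκ' : 0 ≤ κ') (hκ : κ' < κ) (hωY : 0 < ωY) (hwY : ∀ y, ωY ≤ wY y) (hwYμ : ∀ y, wY y ≤ μY)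
    (hDA : ∀ (v : Y) (f : WL2 𝕜 wB V) (F : ℝ), (∀ x, πB x ≠ v → WL2.equiv 𝕜 wB V f x = 0) → (∀ x, ‖WL2.equiv 𝕜 wB V f x‖ ≤ F) →
      ∀ x, ‖WL2.equiv 𝕜 wX VX ((D ∘L A) f) x‖ ≤ BD * Real.exp (-(κ * δ (πX x) v)) * F)
    (hU : ∀ (v : Y) (g : WL2 𝕜 wY V) (F : ℝ), (∀ u, id u ≠ v → WL2.equiv 𝕜 wY V g u = 0) → (∀ u, ‖WL2.equiv 𝕜 wY V g u‖ ≤ F) →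
      ∀ x, ‖WL2.equiv 𝕜 wB V (Uop g) x‖ ≤ BU * Real.exp (-(κ * δ (πB x) v)) * F)
    (hVA : ∀ (v : Y) (f : WL2 𝕜 wB V) (F : ℝ), (∀ x, πB x ≠ v → WL2.equiv 𝕜 wB V f x = 0) → (∀ x, ‖WL2.equiv 𝕜 wB V f x‖ ≤ F) →
      ∀ u, ‖WL2.equiv 𝕜 wY V ((Vop ∘L A) f) u‖ ≤ BV * Real.exp (-(κ' * δ (id u) v)) * F)
    (hC : ∀ (v : Y) (g : WL2 𝕜 wY V) (F : ℝ), (∀ u, id u ≠ v → WL2.equiv 𝕜 wY V g u = 0) → (∀ u, ‖WL2.equiv 𝕜 wY V g u‖ ≤ F) →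
      ∀ u, ‖WL2.equiv 𝕜 wY V (C g) u‖ ≤ Bc * Real.exp (-(κ * δ (id u) v)) * F)
    (hGblk : ∀ z z', ‖P z' ∘L G ∘L P z‖ ≤ A₁ * Real.exp (-(κ * δ z z')))
    (hUblk : ∀ y z, ‖P z ∘L Uop ∘L rY y‖ ≤ CU * Real.exp (-(κ * δ y z)))
    (hVblk : ∀ z y, ‖rY y ∘L Vop ∘L P z‖ ≤ CV * Real.exp (-(κ * δ z y)))
    (hS : ∀ w, ∑ u, Real.exp (-((κ - κ') / 2 * δ w u)) ≤ S)
    (v : Y) (f : WL2 𝕜 wB V) (F : ℝ) (hfv : ∀ x, πB x ≠ v → WL2.equiv 𝕜 wB V f x = 0) (hfF : ∀ x, ‖WL2.equiv 𝕜 wB V f x‖ ≤ F)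
    (x : XX) :
    ‖WL2.equiv 𝕜 wX VX (D (G f)) x‖ ≤
      (BD + BD * BU * Bc * BV * S ^ 3 * (1 + Bc * (CV * A₁ * CU * S ^ 2 * (Real.sqrt μY / Real.sqrt ωY)) * S ^ 2)) *
        Real.exp (-(κ' * δ (πX x) v)) * F := by
  obtain ⟨x₀⟩ := ‹Nonempty XB›
  have hF : 0 ≤ F := (norm_nonneg _).trans (hfF x₀)
  have hS0 : 0 ≤ S := (Finset.sum_nonneg fun u _ => Real.exp_nonneg _).trans (hS v)
  -- the two gaps: `κ − κ′` (outer factors at rate `κ`) and `(κ − κ′)/2` (the core at the middle rate)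
  have hgap : 0 < (κ - κ') / 2 := by linarith
  have hS' : ∀ w, ∑ u, Real.exp (-((κ - κ') * δ w u)) ≤ S := fun w =>
    (Finset.sum_le_sum fun u _ => Real.exp_le_exp.2 (by nlinarith [hδ0 w u])).trans (hS w)
  have hSm : ∀ w, ∑ u, Real.exp (-((κ - (κ + κ') / 2) * δ w u)) ≤ S := fun w => by
    have e : κ - (κ + κ') / 2 = (κ - κ') / 2 := by ring
    rw [e]; exact hS w
  have hSm' : ∀ w, ∑ u, Real.exp (-(((κ + κ') / 2 - κ') * δ w u)) ≤ S := fun w => by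
    have e : (κ + κ') / 2 - κ' = (κ - κ') / 2 := by ring
    rw [e]; exact hS w
  have hκm : κ' ≤ (κ + κ') / 2 := by linarith
  have hκm' : (κ + κ') / 2 ≤ κ := by linarith
  have hκm0 : 0 ≤ (κ + κ') / 2 := by linarith
  -- (a) `T_a = c ∘ (V∘A₀⁻¹)` : bonds → points, `(B_V·B_c·S, κ′)`
  have ha := letter_comp δ πB id id (Vop ∘L A) C hδ0 hδt hBV hBc hκ' le_rfl hVA hC hS'
  -- (b) the core `X = V∘G₁∘Uu` at the middle rate
  have hXblk := core_point_decay πB δ hδ0 hδt hδs hP (rY := rY) G Uop Vop hCV hA₁ hCU hκm0 hκm' hVblk hGblk hUblk hSm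
  have hBX : 0 ≤ CV * A₁ * CU * S ^ 2 := by positivity
  have hX := core_letter_of_point_decay δ hδs hrY (Vop ∘L G ∘L Uop) hBX hωY hwY hwYμ hXblk
  have hBX' : 0 ≤ CV * A₁ * CU * S ^ 2 * Real.sqrt μY / Real.sqrt ωY := by positivity
  -- (c) `T_b = X ∘ T_a` : bonds → points, outer at the middle rate, target `κ′`
  have hb := letter_comp δ πB id id (C ∘L (Vop ∘L A)) (Vop ∘L G ∘L Uop) hδ0 hδt (by positivity) hBX' hκ' le_rfl ha
    (fun v g F hg hF u => by
      have := hX v g F hg hF u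
      calc _ ≤ CV * A₁ * CU * S ^ 2 * Real.sqrt μY / Real.sqrt ωY * Real.exp (-((κ + κ') / 2 * δ (id u) v)) * F := this
        _ = _ := by ring) hSm'
  -- (d) `T_c = c ∘ T_b`
  have hc := letter_comp δ πB id id ((Vop ∘L G ∘L Uop) ∘L (C ∘L (Vop ∘L A))) C hδ0 hδt (by positivity) hBc hκ' le_rfl hb hC hS'
  -- (e) `Uu ∘ T_a`, `Uu ∘ T_c` : bonds → bonds
  have hUa := letter_comp δ πB id πB (C ∘L (Vop ∘L A)) Uop hδ0 hδt (by positivity) hBU hκ' le_rfl ha hU hS'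
  have hUc := letter_comp δ πB id πB (C ∘L ((Vop ∘L G ∘L Uop) ∘L (C ∘L (Vop ∘L A)))) Uop hδ0 hδt (by positivity) hBU hκ' le_rfl hc hU hS'
  -- (f) `(D∘A₀⁻¹) ∘ Uu ∘ T_a`, `(D∘A₀⁻¹) ∘ Uu ∘ T_c` : bonds → the output carriers
  have hW₁ := letter_comp δ πB πB πX (Uop ∘L (C ∘L (Vop ∘L A))) (D ∘L A) hδ0 hδt (by positivity) hBD hκ' le_rfl hUa hDA hS' v f F hfv hfF x
  have hW₂ := letter_comp δ πB πB πX (Uop ∘L (C ∘L ((Vop ∘L G ∘L Uop) ∘L (C ∘L (Vop ∘L A))))) (D ∘L A) hδ0 hδt (by positivity) hBD hκ' le_rfl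
    hUc hDA hS' v f F hfv hfF x
  -- (g) `D∘A₀⁻¹` itself, weakened to the target rate
  have hA' := letter_mono δ πB πX (D ∘L A) hδ0 hBD le_rfl hκ.le hDA v f F hfv hfF x
  -- (h) the identity, post-composed by `D`, applied to `f` and read at `x`
  have e : D (G f) = (D ∘L A) f + ((D ∘L A) ∘L (Uop ∘L (C ∘L (Vop ∘L A)))) f +
      ((D ∘L A) ∘L (Uop ∘L (C ∘L ((Vop ∘L G ∘L Uop) ∘L (C ∘L (Vop ∘L A)))))) f := by
    rw [hW f]
    simp only [add_apply, ContinuousLinearMap.comp_apply, map_add]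
    abel
  rw [e, WL2.equiv_add, WL2.equiv_add, Pi.add_apply, Pi.add_apply]
  have hsum := add_le_add (add_le_add hA' hW₁) hW₂
  refine ((norm_add_le _ _).trans (add_le_add (norm_add_le _ _) le_rfl)).trans (hsum.trans (le_of_eq ?_))
  ring

include hδ0 hδt hδs hP hrY in
/-- **THE LETTER (L) OF `D∘G₁` — END-FACING FORM** (§1 with the right factor `V∘A₀⁻¹` and the two block letters of `Uu`∕`V` DERIVED from the adjoint structure
`Uu† = V`, `A₀⁻¹† = A₀⁻¹` and the INNER value letter (L)(A₀⁻¹; B_A, κ) by (K62) `letter_VA_of_adjoint` ∕ `block_letter_U_of_local` ∕ `block_letter_V_of_adjoint`;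
the OUTER letter (L)(D∘A₀⁻¹; B_D, κ) separate).  CONCLUSION: `‖(D(G₁f))(x)‖ ≤ B⋆_D·e^{−κ′δ(π_X x, v)}·F` with
`B⋆_D = B_D + B_D·B_U·B_c·B_V·S³·(1 + B_c·B_X·S²)`, `B_V = B_U·B_A·S·(μ_B∕ω_Y)`, `B_X = (B_U√μ_B∕√ω_Y)·A₁·(B_U√μ_B∕√ω_Y)·S²·(√μ_Y∕√ω_Y)`. [folklore]
[cite: Balaban1985BackgroundPropagators, (3.25)–(3.26) pp.394–395, Thm 3.1 (3.42) p.397, Thm 3.3 p.399, (3.49) p.399, Thm 3.11 p.416, Thm 3.13 p.426] -/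
theorem local_letter_postcomp_of_adjoint [FiniteDimensional 𝕜 V]
    (hW : ∀ f, G f = A f + A (Uop ((C + C ∘L Vop ∘L G ∘L Uop ∘L C) (Vop (A f)))))
    (hVadj : ContinuousLinearMap.adjoint Uop = Vop) (hAadj : ContinuousLinearMap.adjoint A = A)
    {BD BA BU Bc A₁ κ κ' S ωY μY μB : ℝ} (hBD : 0 ≤ BD) (hBA : 0 ≤ BA) (hBU : 0 ≤ BU) (hBc : 0 ≤ Bc) (hA₁ : 0 ≤ A₁) (hκ' : 0 ≤ κ') (hκ : κ' < κ)
    (hωY : 0 < ωY) (hwY : ∀ y, ωY ≤ wY y) (hwYμ : ∀ y, wY y ≤ μY) (hμB : ∀ u, ∑ x, (if πB x = u then wB x else 0) ≤ μB)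
    (hDA : ∀ (v : Y) (f : WL2 𝕜 wB V) (F : ℝ), (∀ x, πB x ≠ v → WL2.equiv 𝕜 wB V f x = 0) → (∀ x, ‖WL2.equiv 𝕜 wB V f x‖ ≤ F) →
      ∀ x, ‖WL2.equiv 𝕜 wX VX ((D ∘L A) f) x‖ ≤ BD * Real.exp (-(κ * δ (πX x) v)) * F)
    (hA : ∀ (v : Y) (f : WL2 𝕜 wB V) (F : ℝ), (∀ x, πB x ≠ v → WL2.equiv 𝕜 wB V f x = 0) → (∀ x, ‖WL2.equiv 𝕜 wB V f x‖ ≤ F) →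
      ∀ x, ‖WL2.equiv 𝕜 wB V (A f) x‖ ≤ BA * Real.exp (-(κ * δ (πB x) v)) * F)
    (hU : ∀ (v : Y) (g : WL2 𝕜 wY V) (F : ℝ), (∀ u, id u ≠ v → WL2.equiv 𝕜 wY V g u = 0) → (∀ u, ‖WL2.equiv 𝕜 wY V g u‖ ≤ F) →
      ∀ x, ‖WL2.equiv 𝕜 wB V (Uop g) x‖ ≤ BU * Real.exp (-(κ * δ (πB x) v)) * F)
    (hC : ∀ (v : Y) (g : WL2 𝕜 wY V) (F : ℝ), (∀ u, id u ≠ v → WL2.equiv 𝕜 wY V g u = 0) → (∀ u, ‖WL2.equiv 𝕜 wY V g u‖ ≤ F) →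
      ∀ u, ‖WL2.equiv 𝕜 wY V (C g) u‖ ≤ Bc * Real.exp (-(κ * δ (id u) v)) * F)
    (hGblk : ∀ z z', ‖P z' ∘L G ∘L P z‖ ≤ A₁ * Real.exp (-(κ * δ z z')))
    (hS : ∀ w, ∑ u, Real.exp (-((κ - κ') / 2 * δ w u)) ≤ S)
    (v : Y) (f : WL2 𝕜 wB V) (F : ℝ) (hfv : ∀ x, πB x ≠ v → WL2.equiv 𝕜 wB V f x = 0) (hfF : ∀ x, ‖WL2.equiv 𝕜 wB V f x‖ ≤ F)
    (x : XX) :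
    ‖WL2.equiv 𝕜 wX VX (D (G f)) x‖ ≤
      (BD + BD * BU * Bc * (BU * BA * S * (μB / ωY)) * S ^ 3 *
        (1 + Bc * ((BU * Real.sqrt μB / Real.sqrt ωY) * A₁ * (BU * Real.sqrt μB / Real.sqrt ωY) * S ^ 2 * (Real.sqrt μY / Real.sqrt ωY)) *
          S ^ 2)) * Real.exp (-(κ' * δ (πX x) v)) * F := by
  have hS' : ∀ w, ∑ u, Real.exp (-((κ - κ') * δ w u)) ≤ S := fun w =>
    (Finset.sum_le_sum fun u _ => Real.exp_le_exp.2 (by nlinarith [hδ0 w u])).trans (hS w)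
  have hS0 : 0 ≤ S := (Finset.sum_nonneg fun u _ => Real.exp_nonneg _).trans (hS v)
  have hμB0 : 0 ≤ μB := (Finset.sum_nonneg fun x _ => by
    have hw : ∀ x, 0 < wB x := Fact.out
    by_cases hx : πB x = v
    · rw [if_pos hx]; exact (hw x).le
    · rw [if_neg hx]).trans (hμB v)
  -- the derived letters
  have hUblk := block_letter_U_of_local πB δ hδs hP hrY Uop hBU hωY hwY hμB hU
  have hVblk := block_letter_V_of_adjoint πB δ hδs hP hrY Uop Vop hVadj hUblk
  have hVA := letter_VA_of_adjoint πB δ hδ0 hδt hδs hP hrY A Uop Vop hVadj hAadj hBA hBU hκ' hκ.le hωY hwY hμB hA hU hS'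
  exact local_letter_postcomp_of_letters πB πX δ hδ0 hδt hδs hP hrY A G Uop Vop C D hW hBD hBU (by positivity) hBc hA₁ (by positivity) (by positivity)
    hκ' hκ hωY hwY hwYμ hDA hU hVA hC hGblk hUblk hVblk hS v f F hfv hfF x

end Assembly

/-! ## §2 Carriers over the coarse torus `T_m`: the row constant discharged by `torusSum_le`, constant weights -/

section Lattice

variable {𝕜 : Type*} [RCLike 𝕜] {XB XX : Type*} [Fintype XB] [Fintype XX] [Nonempty XB] {d : ℕ} {m : Fin d → ℕ}
  {wB : XB → ℝ} {wX : XX → ℝ} {wY : TSite d m → ℝ} [Fact (∀ x, 0 < wB x)] [Fact (∀ x, 0 < wX x)] [Fact (∀ y, 0 < wY y)]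
  {V VX : Type*} [NormedAddCommGroup V] [InnerProductSpace 𝕜 V] [FiniteDimensional 𝕜 V] [NormedAddCommGroup VX] [InnerProductSpace 𝕜 VX]
  (πB : XB → TSite d m) (πX : XX → TSite d m)
  {P : TSite d m → WL2 𝕜 wB V →L[𝕜] WL2 𝕜 wB V}
  (hP : ∀ (y : TSite d m) (f : WL2 𝕜 wB V) (x : XB), WL2.equiv 𝕜 wB V (P y f) x = if πB x = y then WL2.equiv 𝕜 wB V f x else 0)
  {rY : TSite d m → WL2 𝕜 wY V →L[𝕜] WL2 𝕜 wY V}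
  (hrY : ∀ (y : TSite d m) (g : WL2 𝕜 wY V) (u : TSite d m), WL2.equiv 𝕜 wY V (rY y g) u = if u = y then WL2.equiv 𝕜 wY V g u else 0)
  (A G : WL2 𝕜 wB V →L[𝕜] WL2 𝕜 wB V) (Uop : WL2 𝕜 wY V →L[𝕜] WL2 𝕜 wB V) (Vop : WL2 𝕜 wB V →L[𝕜] WL2 𝕜 wY V)
  (C : WL2 𝕜 wY V →L[𝕜] WL2 𝕜 wY V) (D : WL2 𝕜 wB V →L[𝕜] WL2 𝕜 wX VX)

include hP hrY in
/-- **THE LETTER (L) OF `D∘G₁` OVER THE COARSE TORUS `T_m` AT CONSTANT WEIGHTS** (`δ = d_m`, `S := K_d((κ−κ′)∕2)` by `B4Sect5Torus.torusSum_le`, VOLUME-FREE;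
`1 ≤ m_i`; `w_Y ≡ c₁`, bond-block mass `≤ d_B·c₁`): the Woodbury identity, `Uu† = V`, `A₀⁻¹† = A₀⁻¹`, (L)(D∘A₀⁻¹; B_D, κ) into `(w_X, π_X)`, (L)(A₀⁻¹; B_A, κ),
(L)(Uu; B_U, κ), (L)(c; B_c, κ), the bond-block decay `(A₁, κ)` of `G₁`, `0 ≤ κ′ < κ` ⟹ for every unit site `v`, every bond field `f` supported over `π_B⁻¹(v)` with
`‖f(b)‖ ≤ F`, every output index `x`: `‖(D(G₁f))(x)‖ ≤ B⋆_D·e^{−κ′d_m(π_X x, v)}·F`,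
`B⋆_D = B_D + B_D·B_U·B_c·(B_U·B_A·K·d_B)·K³·(1 + B_c·((B_U√d_B)·A₁·(B_U√d_B)·K²·1)·K²)`, `K = K_d((κ−κ′)∕2)` — (K62) `local_letter_G1_torus_const`'s `B⋆` with the two
outer `B_A` replaced by `B_D`. [folklore] [cite: Balaban1985BackgroundPropagators, (3.25)–(3.26) pp.394–395, Thm 3.1 (3.42) p.397, Thm 3.3 p.399, (3.49) p.399, Thm 3.11
p.416, Thm 3.13 p.426] [cite: Balaban1984PropagatorsII, Lemma 2.1 (2.61) p.234] -/
theorem local_letter_postcomp_torus_const (hm : ∀ i, 1 ≤ m i)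
    (hW : ∀ f, G f = A f + A (Uop ((C + C ∘L Vop ∘L G ∘L Uop ∘L C) (Vop (A f)))))
    (hVadj : ContinuousLinearMap.adjoint Uop = Vop) (hAadj : ContinuousLinearMap.adjoint A = A)
    {BD BA BU Bc A₁ κ κ' c₁ dB : ℝ} (hBD : 0 ≤ BD) (hBA : 0 ≤ BA) (hBU : 0 ≤ BU) (hBc : 0 ≤ Bc) (hA₁ : 0 ≤ A₁) (hκ' : 0 ≤ κ') (hκ : κ' < κ)
    (hc₁ : 0 < c₁) (hwY : ∀ y, wY y = c₁) (hdB : 0 ≤ dB) (hμB : ∀ u, ∑ x, (if πB x = u then wB x else 0) ≤ dB * c₁)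
    (hDA : ∀ (v : TSite d m) (f : WL2 𝕜 wB V) (F : ℝ), (∀ x, πB x ≠ v → WL2.equiv 𝕜 wB V f x = 0) → (∀ x, ‖WL2.equiv 𝕜 wB V f x‖ ≤ F) →
      ∀ x, ‖WL2.equiv 𝕜 wX VX ((D ∘L A) f) x‖ ≤ BD * Real.exp (-(κ * tdist m (πX x) v)) * F)
    (hA : ∀ (v : TSite d m) (f : WL2 𝕜 wB V) (F : ℝ), (∀ x, πB x ≠ v → WL2.equiv 𝕜 wB V f x = 0) → (∀ x, ‖WL2.equiv 𝕜 wB V f x‖ ≤ F) →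
      ∀ x, ‖WL2.equiv 𝕜 wB V (A f) x‖ ≤ BA * Real.exp (-(κ * tdist m (πB x) v)) * F)
    (hU : ∀ (v : TSite d m) (g : WL2 𝕜 wY V) (F : ℝ), (∀ u, id u ≠ v → WL2.equiv 𝕜 wY V g u = 0) → (∀ u, ‖WL2.equiv 𝕜 wY V g u‖ ≤ F) →
      ∀ x, ‖WL2.equiv 𝕜 wB V (Uop g) x‖ ≤ BU * Real.exp (-(κ * tdist m (πB x) v)) * F)
    (hC : ∀ (v : TSite d m) (g : WL2 𝕜 wY V) (F : ℝ), (∀ u, id u ≠ v → WL2.equiv 𝕜 wY V g u = 0) → (∀ u, ‖WL2.equiv 𝕜 wY V g u‖ ≤ F) →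
      ∀ u, ‖WL2.equiv 𝕜 wY V (C g) u‖ ≤ Bc * Real.exp (-(κ * tdist m (id u) v)) * F)
    (hGblk : ∀ z z', ‖P z' ∘L G ∘L P z‖ ≤ A₁ * Real.exp (-(κ * tdist m z z')))
    (v : TSite d m) (f : WL2 𝕜 wB V) (F : ℝ) (hfv : ∀ x, πB x ≠ v → WL2.equiv 𝕜 wB V f x = 0) (hfF : ∀ x, ‖WL2.equiv 𝕜 wB V f x‖ ≤ F)
    (x : XX) :
    ‖WL2.equiv 𝕜 wX VX (D (G f)) x‖ ≤
      (BD + BD * BU * Bc * (BU * BA * latticeConst d ((κ - κ') / 2) * dB) * latticeConst d ((κ - κ') / 2) ^ 3 *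
        (1 + Bc * ((BU * Real.sqrt dB) * A₁ * (BU * Real.sqrt dB) * latticeConst d ((κ - κ') / 2) ^ 2 * 1) *
          latticeConst d ((κ - κ') / 2) ^ 2)) * Real.exp (-(κ' * tdist m (πX x) v)) * F := by
  haveI : Nonempty (TSite d m) := ⟨v⟩
  have hgap : 0 < (κ - κ') / 2 := by linarith
  have h := local_letter_postcomp_of_adjoint πB πX (tdist m) (tdist_nonneg m) (fun u y w => tdist_triangle hm u y w) (tdist_symm hm) hP hrY A G Uop Vop C D
    hW hVadj hAadj (ωY := c₁) (μY := c₁) (μB := dB * c₁) hBD hBA hBU hBc hA₁ hκ' hκ hc₁ (fun y => (hwY y).ge) (fun y => (hwY y).le) hμB hDA hA hU hC hGblk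
    (fun w => torusSum_le d hm hgap w) v f F hfv hfF x
  have hs : 0 < Real.sqrt c₁ := Real.sqrt_pos.2 hc₁
  have e1 : dB * c₁ / c₁ = dB := by field_simp
  have e2 : BU * Real.sqrt (dB * c₁) / Real.sqrt c₁ = BU * Real.sqrt dB := by
    rw [Real.sqrt_mul hdB, mul_div_assoc, mul_div_assoc, div_self hs.ne', mul_one]
  have e3 : Real.sqrt c₁ / Real.sqrt c₁ = 1 := div_self hs.ne'
  rw [e1, e2, e3] at h
  exact h

end Lattice

end Literature.MathematicalPhysics.QuantumFieldTheory.Balaban1983to89.B9Eq326G1PostcompRowOfLetters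

end
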